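import Summits.QuantumAdvantage.AdviceFreeQNC0.SubRowDecimation38B
import Summits.QuantumAdvantage.AdviceFreeQNC0.FibreDecimation37Identity
import HarnessLib

/-!
# Exp38p2 — CORRECTED (NH_{s₀}) and Theorem 38.F (delta over the tree ports `SubRowDecimation38` / `SubRowDecimation38B`)

Cell qa-qnc0, planner qa-qnc0-p2 g38 (memo `HOME/qa-qnc0-p2/ROUND-38P2.md` §1.3 "TYPED FORM", v14b).  CUSTODY (D-0168 E1): not proposed; port-ready
(imports only tree modules; NO tree declaration is re-declared — the corrected forms carry the suffix `R`).

WHY: the tree's `Exp38p2.NHs` / `Exp38p2.FibreNonExact38` (ported verbatim from this seat's v8, p746093) take the short mass at `n = |decimSet|`.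
Lemma 38.C expands only the rows `J'_ε ⊆ J` whose DECODED test is non-constant (a constant decoded row has `|ĉ₀| = 1`), and `shortMass n s₀` is NOT
monotone in `n` (`S(0)=1, S(1,1)=5/3, S(2,1)=1`), so v8's hypothesis under-counts (qn-prover-3 g24, P3-24b).  The tree's `FibreNonExact38` is therefore
SUSPECT AS TYPED (weaker hypothesis than the memo's theorem; do not build on it); the statements below supersede it:
* `decimSetY` (`J_Y`: decimated rows meeting `Y`), `decimSetNC` (`J''`: rows of `J_Y` with `±δ_k` `a`-compatible and `≥ 2` coins on `M` — non-constant
  for EVERY `ε` by Lemma 38.A(ii)), `decimSetE ε` (`J'_ε` itself, via the tree's `Exp37.psi/theta/coefA`); sandwich `J'' ⊆ J'_ε ⊆ J_Y`;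
* `NHsE` = the memo's (NH_{s₀}) verbatim at `J'_ε`, target **`FibreNonExact38E`** (Theorem 38.F, memo-exact; the statement the 37.F′ pipeline proves);
* `NHsR` = the ε-free syntactic form (range clause on `[|J''|, |J_Y|]` + `Λ` over `J_Y`), target `FibreNonExact38R`, inclusion target `SubrowNonconst`
  (= Lemma 38.A(ii)), PROVED `nhsE_of_nhsR`, **`fibreNonExact38R_of_E : SubrowNonconst → FibreNonExact38E → FibreNonExact38R`**;
* PROVED monotonicity `shortMass_succ_le` (`3s₀ ≤ 2n+2 → S(n+1,s₀) ≤ S(n,s₀)`), `shortMass_le_of_le`, `nhsR_range_of_left` (the range clause is checked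
  at its left end point).
`lean check` (farm): rc 0, 0 sorry.  (Tree port, qn-prover-3 g24: verbatim from the custody file, sha a5f2f9b9747ffbc2, + 2 auxiliary docstrings.)
-/

noncomputable section

open Classical

namespace Summit.QuantumAdvantage.AdviceFreeQNC0.Exp38p2

open Finset
open Summit.QuantumAdvantage.AdviceFreeQNC0 F4
open Summit.QuantumAdvantage.AdviceFreeQNC0.Exp37

variable {m z s : ℕ}

/-- The decimated rows that MEET `Y` (the outside coins): `J_Y := {k ∈ J : β_k|_Y ≠ 0}`.  Rows of `J` with `β_k|_Y = 0` contribute a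
constant to the decoded parity and are never expanded (memo §3.3 O-1). -/
def decimSetY (ι : Fin m ↪ Fin z) (a : Fin m → Bool) (β : Fin s → Fin z → ZMod 3) : Finset (Fin s) :=
  (decimSet ι a β).filter fun k => ∃ c : Fin z, c ∉ Set.range ι ∧ β k c ≠ 0

/-- The rows of `J_Y` whose decoded test is non-constant FOR EVERY coset parity `ε` by Lemma 38.A (ii): `±δ_k` is `a`-compatible with at least
two non-zero entries (`A_k = U₂(α + n') ≠ 0`, `B_k = 0`, or symmetrically).  `J'' ⊆ J'_ε ⊆ J_Y` for the set `J'_ε` actually expanded in STEP 3. -/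
def decimSetNC (ι : Fin m ↪ Fin z) (a : Fin m → Bool) (β : Fin s → Fin z → ZMod 3) : Finset (Fin s) :=
  (decimSetY ι a β).filter fun k =>
    (Compatible a (restrictM ι β k) ∨ Compatible a (-restrictM ι β k)) ∧ 2 ≤ (univ.filter fun i => β k (ι i) ≠ 0).card

/-- **Hypothesis (NH_{s₀}) — v9, CORRECTED (qn-prover-3 g24, P3-24b).**  Lemma 38.C expands the set `J'_ε := {k ∈ J : β_k|_Y ≠ 0 ∧ ψ_k`
non-constant`}` (`n := |J'_ε|`), which depends on the coset parity `ε` through the decoded coefficients; a CONSTANT decoded row has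
`|ĉ_0| = 1` (not `1/3`), so the short mass must be taken at `n = |J'_ε|`, and `S(n,s₀)` is NOT monotone in `n` — v8's `shortMass |J| s₀ ≤ 1/10`
was therefore NOT stronger than the memo's hypothesis (it under-counts when `J` has constant rows).  The ε-free, syntactic form below sandwiches
`|J''| ≤ |J'_ε| ≤ |J_Y|` (`decimSetNC ⊆ J'_ε ⊆ decimSetY`) and asks the short-mass bound on the whole range, and the long `3/4`-mass over the
LARGER index set `J_Y` (a superset only enlarges `Λ`, so this half IS stronger).  Since `S(n+1,s₀) ≤ S(n,s₀)` as soon as `3s₀ ≤ 2n + 2`, the range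
condition is in practice `S(|J''|, s₀) ≤ 1/10`. -/
def NHsR (ι : Fin m ↪ Fin z) (a : Fin m → Bool) (β : Fin s → Fin z → ZMod 3) (s₀ : ℕ) : Prop :=
  (∀ n : ℕ, (decimSetNC ι a β).card ≤ n → n ≤ (decimSetY ι a β).card → shortMass n s₀ ≤ 1 / 10) ∧
  (∑ j ∈ (univ : Finset (Fin s → ZMod 3)).filter
      (fun j => s₀ < relSuppCard j ∧ ∀ k, k ∉ decimSetY ι a β → j k = 0),
      ((3 : ℝ) / 4) ^ weightY ι β j) ≤ 1 / 100

/-- auxiliary lemma `decimSetNC_subset_decimSetY` (planner p2 g38, exp38p2; ported verbatim). -/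
theorem decimSetNC_subset_decimSetY (ι : Fin m ↪ Fin z) (a : Fin m → Bool) (β : Fin s → Fin z → ZMod 3) :
    decimSetNC ι a β ⊆ decimSetY ι a β := filter_subset _ _

/-- auxiliary lemma `decimSetY_subset_decimSet` (planner p2 g38, exp38p2; ported verbatim). -/
theorem decimSetY_subset_decimSet (ι : Fin m ↪ Fin z) (a : Fin m → Bool) (β : Fin s → Fin z → ZMod 3) :
    decimSetY ι a β ⊆ decimSet ι a β := filter_subset _ _

/-! ### Monotonicity of the short mass (v10) -/

/-- Term ratio: `2·C(n,t)4^t ≤ C(n,t+1)4^{t+1}` while `3t + 1 ≤ 2n`. -/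
theorem shortMass_term_step (n t : ℕ) (h : 3 * t + 1 ≤ 2 * n) :
    2 * (((n.choose t : ℕ) : ℝ) * 4 ^ t) ≤ ((n.choose (t + 1) : ℕ) : ℝ) * 4 ^ (t + 1) := by
  have ht : t ≤ n := by omega
  have key : ((n.choose (t + 1) : ℕ) : ℝ) * ((t : ℝ) + 1) = ((n.choose t : ℕ) : ℝ) * ((n : ℝ) - t) := by
    have e := Nat.choose_succ_right_eq n t
    have e' : ((n.choose (t + 1) * (t + 1) : ℕ) : ℝ) = ((n.choose t * (n - t) : ℕ) : ℝ) := by rw [e]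
    push_cast at e'
    rw [Nat.cast_sub ht] at e'
    exact e'
  have hpos : (0 : ℝ) < (t : ℝ) + 1 := by positivity
  have hc : (0 : ℝ) ≤ ((n.choose t : ℕ) : ℝ) * 4 ^ t := by positivity
  have h4 : (2 : ℝ) * ((t : ℝ) + 1) ≤ 4 * ((n : ℝ) - t) := by
    have : (3 * t + 1 : ℝ) ≤ 2 * n := by exact_mod_cast h
    linarith
  have H : 2 * (((n.choose t : ℕ) : ℝ) * 4 ^ t) * ((t : ℝ) + 1)
      ≤ ((n.choose (t + 1) : ℕ) : ℝ) * 4 ^ (t + 1) * ((t : ℝ) + 1) := by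
    calc 2 * (((n.choose t : ℕ) : ℝ) * 4 ^ t) * ((t : ℝ) + 1)
        = (2 * ((t : ℝ) + 1)) * (((n.choose t : ℕ) : ℝ) * 4 ^ t) := by ring
      _ ≤ (4 * ((n : ℝ) - t)) * (((n.choose t : ℕ) : ℝ) * 4 ^ t) := mul_le_mul_of_nonneg_right h4 hc
      _ = (((n.choose t : ℕ) : ℝ) * ((n : ℝ) - t)) * 4 ^ (t + 1) := by ring
      _ = (((n.choose (t + 1) : ℕ) : ℝ) * ((t : ℝ) + 1)) * 4 ^ (t + 1) := by rw [key]
      _ = ((n.choose (t + 1) : ℕ) : ℝ) * 4 ^ (t + 1) * ((t : ℝ) + 1) := by ring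
  exact le_of_mul_le_mul_right H hpos

/-- Geometric domination: `Σ_{t<s} C(n,t)4^t ≤ C(n,s)4^s` while `3s ≤ 2n + 2`. -/
theorem shortMass_sum_lt_le (n : ℕ) : ∀ s : ℕ, 3 * s ≤ 2 * n + 2 →
    ∑ t ∈ range s, (((n.choose t : ℕ) : ℝ) * 4 ^ t) ≤ ((n.choose s : ℕ) : ℝ) * 4 ^ s := by
  intro s
  induction s with
  | zero => intro _; simp
  | succ s ih =>
    intro hs
    rw [sum_range_succ]
    have h1 := ih (by omega)
    have h2 := shortMass_term_step n s (by omega)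
    linarith

/-- Pascal: `Σ_{t≤s} C(n+1,t)4^t = Σ_{t≤s} C(n,t)4^t + 4·Σ_{t<s} C(n,t)4^t`. -/
theorem shortMass_pascal (n s : ℕ) :
    ∑ t ∈ range (s + 1), ((((n + 1).choose t : ℕ) : ℝ) * 4 ^ t)
      = ∑ t ∈ range (s + 1), (((n.choose t : ℕ) : ℝ) * 4 ^ t) + 4 * ∑ t ∈ range s, (((n.choose t : ℕ) : ℝ) * 4 ^ t) := by
  induction s with
  | zero => simp
  | succ s ih =>
    have e1 : ∑ t ∈ range (s + 1 + 1), ((((n + 1).choose t : ℕ) : ℝ) * 4 ^ t)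
        = (∑ t ∈ range (s + 1), ((((n + 1).choose t : ℕ) : ℝ) * 4 ^ t))
          + (((n + 1).choose (s + 1) : ℕ) : ℝ) * 4 ^ (s + 1) := sum_range_succ _ _
    have e2 : ∑ t ∈ range (s + 1 + 1), (((n.choose t : ℕ) : ℝ) * 4 ^ t)
        = (∑ t ∈ range (s + 1), (((n.choose t : ℕ) : ℝ) * 4 ^ t)) + ((n.choose (s + 1) : ℕ) : ℝ) * 4 ^ (s + 1) :=
      sum_range_succ _ _
    have e3 : ∑ t ∈ range (s + 1), (((n.choose t : ℕ) : ℝ) * 4 ^ t)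
        = (∑ t ∈ range s, (((n.choose t : ℕ) : ℝ) * 4 ^ t)) + ((n.choose s : ℕ) : ℝ) * 4 ^ s := sum_range_succ _ _
    have e4 : (((n + 1).choose (s + 1) : ℕ) : ℝ) = ((n.choose s : ℕ) : ℝ) + ((n.choose (s + 1) : ℕ) : ℝ) := by
      rw [Nat.choose_succ_succ]; push_cast; ring
    rw [e1, ih, e2, e4, e3]
    ring

/-- **Monotonicity of the short mass** (memo §1.3, v10): `S(n+1,s₀) ≤ S(n,s₀)` as soon as `3s₀ ≤ 2n + 2`.  Hence the range clause of
`NHs` reduces to its left end point: `S(|J''|,s₀) ≤ 1/10` (with `3s₀ ≤ 2|J''| + 2`) gives `S(n,s₀) ≤ 1/10` for every `n ≥ |J''|`. -/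
theorem shortMass_succ_le {n s₀ : ℕ} (h : 3 * s₀ ≤ 2 * n + 2) : shortMass (n + 1) s₀ ≤ shortMass n s₀ := by
  unfold shortMass
  rw [shortMass_pascal]
  have hB := shortMass_sum_lt_le n s₀ h
  have e3 : ∑ t ∈ range (s₀ + 1), (((n.choose t : ℕ) : ℝ) * 4 ^ t)
      = (∑ t ∈ range s₀, (((n.choose t : ℕ) : ℝ) * 4 ^ t)) + ((n.choose s₀ : ℕ) : ℝ) * 4 ^ s₀ := sum_range_succ _ _
  rw [e3]
  have hA : (0 : ℝ) ≤ ∑ t ∈ range s₀, (((n.choose t : ℕ) : ℝ) * 4 ^ t) := sum_nonneg fun t _ => by positivity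
  have h3 : (0 : ℝ) < (3 : ℝ)⁻¹ ^ n := by positivity
  have hprod := mul_nonneg h3.le (sub_nonneg.mpr hB)
  rw [pow_succ]
  nlinarith [hprod, hA, h3, hB]

/-- Iterated: `S(n,s₀) ≤ S(n₀,s₀)` for all `n ≥ n₀` once `3s₀ ≤ 2n₀ + 2`. -/
theorem shortMass_le_of_le {n₀ n s₀ : ℕ} (h : 3 * s₀ ≤ 2 * n₀ + 2) (hn : n₀ ≤ n) : shortMass n s₀ ≤ shortMass n₀ s₀ := by
  induction n, hn using Nat.le_induction with
  | base => exact le_rfl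
  | succ k hk ih => exact (shortMass_succ_le (by omega)).trans ih

/-- The range clause of `NHsR` from its left end point (users of Theorem 38.F check ONE number). -/
theorem nhsR_range_of_left (ι : Fin m ↪ Fin z) (a : Fin m → Bool) (β : Fin s → Fin z → ZMod 3) {s₀ : ℕ}
    (h3 : 3 * s₀ ≤ 2 * (decimSetNC ι a β).card + 2) (hS : shortMass (decimSetNC ι a β).card s₀ ≤ 1 / 10) :
    ∀ n : ℕ, (decimSetNC ι a β).card ≤ n → n ≤ (decimSetY ι a β).card → shortMass n s₀ ≤ 1 / 10 :=
  fun _ h1 _ => (shortMass_le_of_le h3 h1).trans hS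

/-- **Theorem 38.F (the fibre theorem of gen 38), typed target.**  `m` odd, `|Y| ≥ 1`; the base row `k₀` is `a`-COMPATIBLE on the chosen coins
(zeros allowed) with at least two non-zero entries (Lemma 38.A); (NH_{s₀}) for some `s₀` (Lemma 38.C; v9 corrected form).  Then every 𝔽₂-affine target is missed
on at least a `2^{−m−3}` fraction of the parity coset.  (37.F′ = the case `restrictM ι β k₀` nowhere zero and `s₀ = 0`.) -/
def FibreNonExact38R : Prop :=
  ∀ (z s m : ℕ) (ι : Fin m ↪ Fin z) (β : Fin s → Fin z → ZMod 3) (r : Fin s → ZMod 3) (k₀ : Fin s)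
    (a : Fin m → Bool) (s₀ : ℕ),
    Odd m → 1 ≤ z - m →
    Compatible a (restrictM ι β k₀) →
    2 ≤ (univ.filter fun i => β k₀ (ι i) ≠ 0).card →
    NHsR ι a β s₀ →
    ∀ (ε μ₀ : ℕ) (S : Finset (Fin z)),
      (((coset z ε).filter fun u => testParity β r u % 2 = affTarget μ₀ S u % 2).card : ℝ)
        ≤ (1 - (2 : ℝ)⁻¹ ^ (m + 3)) * (2 : ℝ) ^ (z - 1)

/-! ### (NH_{s₀}) at the set actually expanded (`J'_ε`, v11) — the memo-exact form of Theorem 38.F and its reduction -/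

/-- The set ACTUALLY expanded in STEP 3 for the coset parity `ε` (the memo's `J'_ε`): decimated rows meeting `Y` whose decoded test
`ψ_k = psi θ A_k B_k` (tree `Exp37.psi`, `Exp37.theta`, `Exp37.coefA`) is non-constant.  `decimSetNC ⊆ decimSetE ε ⊆ decimSetY`; the first
inclusion is Lemma 38.A(ii) (`SubrowNonconst` below, to be proved next to `coefA_pattern`), the second is `filter_subset`. -/
def decimSetE (ι : Fin m ↪ Fin z) (a : Fin m → Bool) (β : Fin s → Fin z → ZMod 3) (ε : ℕ) : Finset (Fin s) :=
  (decimSetY ι a β).filter fun k => ∃ t t' : ZMod 3,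
    psi (theta a ε) (coefA a ε (restrictM ι β k)) (coefA a ε (-restrictM ι β k)) t ≠
      psi (theta a ε) (coefA a ε (restrictM ι β k)) (coefA a ε (-restrictM ι β k)) t'

/-- auxiliary lemma `decimSetE_subset_decimSetY` (planner p2 g38, exp38p2; ported verbatim). -/
theorem decimSetE_subset_decimSetY (ι : Fin m ↪ Fin z) (a : Fin m → Bool) (β : Fin s → Fin z → ZMod 3) (ε : ℕ) :
    decimSetE ι a β ε ⊆ decimSetY ι a β := filter_subset _ _

/-- **(NH_{s₀}) at `J'_ε`** — verbatim the memo's hypothesis of Lemma 38.C (`n := |J'_ε|`, `Λ_{s₀}` over `𝔽₃^{J'_ε}`). -/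
def NHsE (ι : Fin m ↪ Fin z) (a : Fin m → Bool) (β : Fin s → Fin z → ZMod 3) (ε s₀ : ℕ) : Prop :=
  shortMass (decimSetE ι a β ε).card s₀ ≤ 1 / 10 ∧
  (∑ j ∈ (univ : Finset (Fin s → ZMod 3)).filter
      (fun j => s₀ < relSuppCard j ∧ ∀ k, k ∉ decimSetE ι a β ε → j k = 0),
      ((3 : ℝ) / 4) ^ weightY ι β j) ≤ 1 / 100

/-- **Theorem 38.F, memo-exact form (target; the one the pipeline proves):** as `FibreNonExact38R` but with (NH_{s₀}) asked of the set `J'_ε`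
actually expanded, separately for each coset parity `ε`. -/
def FibreNonExact38E : Prop :=
  ∀ (z s m : ℕ) (ι : Fin m ↪ Fin z) (β : Fin s → Fin z → ZMod 3) (r : Fin s → ZMod 3) (k₀ : Fin s)
    (a : Fin m → Bool) (s₀ : ℕ),
    Odd m → 1 ≤ z - m →
    Compatible a (restrictM ι β k₀) →
    2 ≤ (univ.filter fun i => β k₀ (ι i) ≠ 0).card →
    ∀ (ε μ₀ : ℕ) (S : Finset (Fin z)), NHsE ι a β ε s₀ →
      (((coset z ε).filter fun u => testParity β r u % 2 = affTarget μ₀ S u % 2).card : ℝ)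
        ≤ (1 - (2 : ℝ)⁻¹ ^ (m + 3)) * (2 : ℝ) ^ (z - 1)

/-- **Lemma 38.A (ii) as an inclusion (target):** a decimated row meeting `Y` with `±δ_k` `a`-compatible and `≥ 2` non-zero entries on `M`
decodes to a NON-constant test for every `ε` (`A_k = U₂(α + n') ≠ 0, B_k = 0`, or symmetrically; `m` odd). -/
def SubrowNonconst : Prop :=
  ∀ (z s m : ℕ) (ι : Fin m ↪ Fin z) (a : Fin m → Bool) (β : Fin s → Fin z → ZMod 3) (ε : ℕ),
    Odd m → decimSetNC ι a β ⊆ decimSetE ι a β ε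

/-- The syntactic hypothesis implies the memo-exact one (sandwich + `Λ` monotone under enlarging the index set). -/
theorem nhsE_of_nhsR (ι : Fin m ↪ Fin z) (a : Fin m → Bool) (β : Fin s → Fin z → ZMod 3) {ε s₀ : ℕ}
    (hincl : decimSetNC ι a β ⊆ decimSetE ι a β ε) (h : NHsR ι a β s₀) : NHsE ι a β ε s₀ := by
  refine ⟨h.1 _ (card_le_card hincl) (card_le_card (decimSetE_subset_decimSetY ι a β ε)), le_trans ?_ h.2⟩
  apply sum_le_sum_of_subset_of_nonneg
  · intro j hj
    simp only [mem_filter, mem_univ, true_and] at hj ⊢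
    exact ⟨hj.1, fun k hk => hj.2 k fun hk' => hk (decimSetE_subset_decimSetY ι a β ε hk')⟩
  · intro j _ _
    positivity

/-- **Reduction:** the memo-exact Theorem 38.F and Lemma 38.A(ii) give the syntactic (corrected) Theorem 38.F. -/
theorem fibreNonExact38R_of_E (hA : SubrowNonconst) (hE : FibreNonExact38E) : FibreNonExact38R := by
  intro z s m ι β r k₀ a s₀ hm hz hc h2 hN ε μ₀ S
  exact hE z s m ι β r k₀ a s₀ hm hz hc h2 ε μ₀ S (nhsE_of_nhsR ι a β (hA z s m ι a β ε hm) hN)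
end Summit.QuantumAdvantage.AdviceFreeQNC0.Exp38p2

end
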